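import Literature.NumberTheory.Transcendental.ExpPointsGeometryBasic
import Literature.Analysis.Complex.PuiseuxAtInfinityAtlas
import Literature.Analysis.Complex.MeromorphicCurveGerms
import HarnessLib

/-!
# Independent exponential points accumulate on an analytic branch at infinity

Let `W ⊆ ℂ² × ℂ²` be Zariski closed with `zariskiDim ℂ W < 2`, and let `T` be a set of
independent exponential points of `W` (`T ⊆ indepExpPoints W`) which is unbounded in the first
coordinate in the strong sense `∀ R, {x ∈ T | R < ‖x 0‖}` infinite. Then
(`exists_branch_through_hits`) there is a germ of analytic curve at infinity
`t ↦ 𝔟(t) = ((t⁻ᵉ, Φ₁(t) t⁻ᴺ), (Φ₂(t) t⁻ᴺ, Φ₃(t) t⁻ᴺ))`, `Φⱼ` analytic on `|t| < r`, contained in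
`W` for `0 < |t| < r`, passing through infinitely many points `(x, eˣ)`, `x ∈ T`, with
parameters `t` in every punctured disc `0 < |t| < δ`.

Proof: the three pairs of coordinates `(x₀, x₁)`, `(x₀, y₀)`, `(x₀, y₁)` satisfy non-trivial
polynomial relations on `W` (`ZariskiDimCoordRelations`); near `x₀ = ∞` their solutions lie on
finitely many Puiseux branches (`PuiseuxAtInfinityAtlas`); a pigeonhole preserving unboundedness
(`ExpPointsGeometryBasic`) selects one branch for each pair, with a common master root
`t = x₀^{-1/e}`; the resulting curve germ has meromorphic coordinates, and every defining
polynomial of `W` vanishes on it frequently near `t = 0`, hence on a punctured disc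
(`MeromorphicCurveGerms`). No irreducible decomposition or normalisation of `W` is needed.
PROVED, no definition. [folklore]
-/

noncomputable section

open Complex Filter Topology Set Metric MvPolynomial

namespace Literature.NumberTheory.Transcendental

open Literature.Analysis.Complex.PuiseuxInfinity (exists_branch_atlas)
open Literature.Analysis.Complex.MeromorphicGerm (analyticAt_pow_succ_mul_div_pow
  analyticAt_pow_succ_mul_inv_pow exists_analyticAt_pow_mul_aeval exists_radius_eq_zero
  frequently_nhdsNE_of_forall_exists ne_zero_and_norm_lt_of_pow_eq_inv)

/-- The branch point `((t⁻ᵉ, Φ₁ t / tᴺ), (Φ₂ t / tᴺ, Φ₃ t / tᴺ)) ∈ ℂ² × ℂ²` (local notation). -/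
local notation3 "𝔟[" e ", " N ", " Φ₁ ", " Φ₂ ", " Φ₃ ", " t "]" =>
  (Sum.elim ![((t : ℂ) ^ (e : ℕ))⁻¹, (Φ₁ : ℂ → ℂ) t / t ^ (N : ℕ)]
    ![(Φ₂ : ℂ → ℂ) t / t ^ (N : ℕ), (Φ₃ : ℂ → ℂ) t / t ^ (N : ℕ)] : Fin 2 ⊕ Fin 2 → ℂ)

/-- Rescaling an atlas function: `y(tᵐ)/(tᵐ)^M = (y(tᵐ) t^{N - mM})/t^N` for `mM ≤ N`, `t ≠ 0`.
[folklore] -/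
theorem div_pow_eq_rescale {y : ℂ → ℂ} {t : ℂ} (ht : t ≠ 0) {m M N : ℕ} (h : m * M ≤ N) :
    y (t ^ m) / (t ^ m) ^ M = y (t ^ m) * t ^ (N - m * M) / t ^ N := by
  rw [← pow_mul, div_eq_div_iff (pow_ne_zero _ ht) (pow_ne_zero _ ht), mul_assoc, ← pow_add,
    Nat.sub_add_cancel h]

/-- An atlas function composed with `t ↦ tᵐ` (`m ≥ 1`) and rescaled is analytic on the small
ball. [folklore] -/
theorem analyticAt_rescale {y : ℂ → ℂ} {ρ r : ℝ} (hy : DifferentiableOn ℂ y (ball 0 ρ))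
    (hr1 : r ≤ 1) (hrρ : r ≤ ρ) {m : ℕ} (hm : 0 < m) (k : ℕ) {t : ℂ} (ht : ‖t‖ < r) :
    AnalyticAt ℂ (fun s : ℂ => y (s ^ m) * s ^ k) t := by
  have hmaps : MapsTo (fun s : ℂ => s ^ m) (ball 0 r) (ball 0 ρ) := by
    intro s hs
    rw [mem_ball_zero_iff] at hs ⊢
    rw [norm_pow]
    calc ‖s‖ ^ m ≤ ‖s‖ := pow_le_of_le_one (norm_nonneg s) (hs.le.trans hr1) hm.ne'
      _ < r := hs
      _ ≤ ρ := hrρ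
  have hd : DifferentiableOn ℂ (fun s : ℂ => y (s ^ m) * s ^ k) (ball 0 r) :=
    (hy.comp (by fun_prop) hmaps).mul (by fun_prop)
  exact hd.analyticAt (isOpen_ball.mem_nhds (mem_ball_zero_iff.2 ht))

/-- **An unbounded family of independent exponential points accumulates on an analytic branch
at infinity contained in `W`.** See the module docstring. [folklore] -/
theorem exists_branch_through_hits {W : Set (Fin 2 ⊕ Fin 2 → ℂ)} (hcl : IsZariskiClosed ℂ W)
    (hdim : zariskiDim ℂ W < 2) {T : Set (Fin 2 → ℂ)} (hTW : T ⊆ indepExpPoints W)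
    (hT : ∀ R : ℝ, Set.Infinite {x | x ∈ T ∧ R < ‖x 0‖}) :
    ∃ (e : ℕ) (_ : 0 < e) (N : ℕ) (r : ℝ) (_ : 0 < r) (Φ₁ Φ₂ Φ₃ : ℂ → ℂ),
      (∀ t : ℂ, ‖t‖ < r → AnalyticAt ℂ Φ₁ t ∧ AnalyticAt ℂ Φ₂ t ∧ AnalyticAt ℂ Φ₃ t) ∧
      (∀ t : ℂ, 0 < ‖t‖ → ‖t‖ < r → 𝔟[e, N, Φ₁, Φ₂, Φ₃, t] ∈ W) ∧
      ∀ δ : ℝ, 0 < δ → Set.Infinite {x | x ∈ T ∧ ∃ t : ℂ, 0 < ‖t‖ ∧ ‖t‖ < δ ∧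
        Sum.elim x (Complex.exp ∘ x) = 𝔟[e, N, Φ₁, Φ₂, Φ₃, t]} := by
  classical
  -- ### relations and atlases
  obtain ⟨P₁, hP₁, hrel₁⟩ := exists_relation_pair_of_zariskiDim_lt_two W hdim (Sum.inl 0) (Sum.inl 1)
  obtain ⟨P₂, hP₂, hrel₂⟩ := exists_relation_pair_of_zariskiDim_lt_two W hdim (Sum.inl 0) (Sum.inr 0)
  obtain ⟨P₃, hP₃, hrel₃⟩ := exists_relation_pair_of_zariskiDim_lt_two W hdim (Sum.inl 0) (Sum.inr 1)
  obtain ⟨e₁, he₁, R₁, r₁, hr₁, hr₁1, B₁, hB₁, hat₁⟩ := exists_branch_atlas P₁ hP₁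
  obtain ⟨e₂, he₂, R₂, r₂, hr₂, hr₂1, B₂, hB₂, hat₂⟩ := exists_branch_atlas P₂ hP₂
  obtain ⟨e₃, he₃, R₃, r₃, hr₃, hr₃1, B₃, hB₃, hat₃⟩ := exists_branch_atlas P₃ hP₃
  set e : ℕ := e₁ * e₂ * e₃ with he_def
  have he : 0 < e := Nat.mul_pos (Nat.mul_pos he₁ he₂) he₃
  set m₁ : ℕ := e₂ * e₃ with hm₁
  set m₂ : ℕ := e₁ * e₃ with hm₂
  set m₃ : ℕ := e₁ * e₂ with hm₃
  have hm₁e : m₁ * e₁ = e := by rw [hm₁, he_def]; ring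
  have hm₂e : m₂ * e₂ = e := by rw [hm₂, he_def]; ring
  have hm₃e : m₃ * e₃ = e := by rw [hm₃, he_def]
  have hm₁pos : 0 < m₁ := Nat.mul_pos he₂ he₃
  have hm₂pos : 0 < m₂ := Nat.mul_pos he₁ he₃
  have hm₃pos : 0 < m₃ := Nat.mul_pos he₁ he₂
  -- ### the master root
  have hroot : ∀ x : Fin 2 → ℂ, ∃ t : ℂ, t ^ e = (x 0)⁻¹ := fun x =>
    IsAlgClosed.exists_pow_nat_eq _ he
  choose tr htr using hroot
  have htr₁ : ∀ x, (tr x ^ m₁) ^ e₁ = (x 0)⁻¹ := fun x => by rw [← pow_mul, hm₁e, htr]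
  have htr₂ : ∀ x, (tr x ^ m₂) ^ e₂ = (x 0)⁻¹ := fun x => by rw [← pow_mul, hm₂e, htr]
  have htr₃ : ∀ x, (tr x ^ m₃) ^ e₃ = (x 0)⁻¹ := fun x => by rw [← pow_mul, hm₃e, htr]
  -- ### values at hits
  have hvals : ∀ x ∈ T, MvPolynomial.eval ![x 0, x 1] P₁ = 0 ∧
      MvPolynomial.eval ![x 0, exp (x 0)] P₂ = 0 ∧ MvPolynomial.eval ![x 0, exp (x 1)] P₃ = 0 :=
    fun x hx => ⟨hrel₁ (Sum.elim x (exp ∘ x)) (hTW hx).2, hrel₂ (Sum.elim x (exp ∘ x)) (hTW hx).2,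
      hrel₃ (Sum.elim x (exp ∘ x)) (hTW hx).2⟩
  -- ### representation of the large hits and the pigeonhole
  set R : ℝ := max R₁ (max R₂ R₃) with hR
  set U : ((ℂ → ℂ) × ℕ) × (((ℂ → ℂ) × ℕ) × ((ℂ → ℂ) × ℕ)) → Set (Fin 2 → ℂ) := fun b =>
    {x | x 1 = b.1.1 (tr x ^ m₁) / (tr x ^ m₁) ^ b.1.2 ∧
      exp (x 0) = b.2.1.1 (tr x ^ m₂) / (tr x ^ m₂) ^ b.2.1.2 ∧
      exp (x 1) = b.2.2.1 (tr x ^ m₃) / (tr x ^ m₃) ^ b.2.2.2} with hU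
  set T' : Set (Fin 2 → ℂ) := {x | x ∈ T ∧ R < ‖x 0‖} with hT'def
  have hT' : ∀ R' : ℝ, Set.Infinite {x | x ∈ T' ∧ R' < ‖x 0‖} := by
    intro R'
    refine (hT (max R R')).mono ?_
    rintro x ⟨hx, hRx⟩
    exact ⟨⟨hx, lt_of_le_of_lt (le_max_left _ _) hRx⟩, lt_of_le_of_lt (le_max_right _ _) hRx⟩
  have hcov : ∀ x ∈ T', ∃ b ∈ B₁ ×ˢ (B₂ ×ˢ B₃), x ∈ U b := by
    rintro x ⟨hx, hRx⟩
    obtain ⟨h1, h2, h3⟩ := hvals x hx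
    have hR₁x : R₁ < ‖x 0‖ := lt_of_le_of_lt (le_max_left _ _) hRx
    have hR₂x : R₂ < ‖x 0‖ := lt_of_le_of_lt ((le_max_left _ _).trans (le_max_right _ _)) hRx
    have hR₃x : R₃ < ‖x 0‖ := lt_of_le_of_lt ((le_max_right _ _).trans (le_max_right _ _)) hRx
    obtain ⟨-, -, b₁, hb₁, hv₁⟩ := hat₁ (x 0) (x 1) hR₁x h1 (tr x ^ m₁) (htr₁ x)
    obtain ⟨-, -, b₂, hb₂, hv₂⟩ := hat₂ (x 0) (exp (x 0)) hR₂x h2 (tr x ^ m₂) (htr₂ x)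
    obtain ⟨-, -, b₃, hb₃, hv₃⟩ := hat₃ (x 0) (exp (x 1)) hR₃x h3 (tr x ^ m₃) (htr₃ x)
    exact ⟨(b₁, (b₂, b₃)), Finset.mk_mem_product hb₁ (Finset.mk_mem_product hb₂ hb₃), hv₁, hv₂, hv₃⟩
  obtain ⟨b, hb, hcls⟩ := exists_infinite_class hT' (B₁ ×ˢ (B₂ ×ˢ B₃)) U hcov
  obtain ⟨⟨y₁, M₁⟩, ⟨y₂, M₂⟩, ⟨y₃, M₃⟩⟩ := b
  simp only [Finset.mem_product] at hb
  obtain ⟨hy₁, hy₂, hy₃⟩ := hb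
  -- ### the branch
  set N : ℕ := m₁ * M₁ + m₂ * M₂ + m₃ * M₃ with hN
  have hN₁ : m₁ * M₁ ≤ N := by rw [hN]; omega
  have hN₂ : m₂ * M₂ ≤ N := by rw [hN]; omega
  have hN₃ : m₃ * M₃ ≤ N := by rw [hN]; omega
  set Φ₁ : ℂ → ℂ := fun t => y₁ (t ^ m₁) * t ^ (N - m₁ * M₁) with hΦ₁
  set Φ₂ : ℂ → ℂ := fun t => y₂ (t ^ m₂) * t ^ (N - m₂ * M₂) with hΦ₂
  set Φ₃ : ℂ → ℂ := fun t => y₃ (t ^ m₃) * t ^ (N - m₃ * M₃) with hΦ₃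
  set r₀ : ℝ := min 1 (min r₁ (min r₂ r₃)) with hr₀
  have hr₀pos : 0 < r₀ := lt_min one_pos (lt_min hr₁ (lt_min hr₂ hr₃))
  have hr₀1 : r₀ ≤ 1 := min_le_left _ _
  have hr₀₁ : r₀ ≤ r₁ := (min_le_right _ _).trans (min_le_left _ _)
  have hr₀₂ : r₀ ≤ r₂ := (min_le_right _ _).trans ((min_le_right _ _).trans (min_le_left _ _))
  have hr₀₃ : r₀ ≤ r₃ := (min_le_right _ _).trans ((min_le_right _ _).trans (min_le_right _ _))
  have hanΦ : ∀ t : ℂ, ‖t‖ < r₀ → AnalyticAt ℂ Φ₁ t ∧ AnalyticAt ℂ Φ₂ t ∧ AnalyticAt ℂ Φ₃ t :=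
    fun t ht => ⟨analyticAt_rescale (hB₁ _ hy₁) hr₀1 hr₀₁ hm₁pos _ ht,
      analyticAt_rescale (hB₂ _ hy₂) hr₀1 hr₀₂ hm₂pos _ ht,
      analyticAt_rescale (hB₃ _ hy₃) hr₀1 hr₀₃ hm₃pos _ ht⟩
  -- the hits of the class lie on the branch
  have hpt : ∀ x : Fin 2 → ℂ, x ∈ U ((y₁, M₁), ((y₂, M₂), (y₃, M₃))) → tr x ≠ 0 →
      Sum.elim x (exp ∘ x) = 𝔟[e, N, Φ₁, Φ₂, Φ₃, tr x] := by
    rintro x ⟨hx1, hx2, hx3⟩ ht0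
    dsimp only at hx1 hx2 hx3
    funext k
    rcases k with k | k <;> fin_cases k
    · simp only [Sum.elim_inl, Fin.zero_eta, Fin.isValue, Matrix.cons_val_zero]
      rw [htr, inv_inv]
    · simp only [Sum.elim_inl, Fin.mk_one, Fin.isValue, Matrix.cons_val_one, Matrix.cons_val_zero]
      rw [hx1, div_pow_eq_rescale ht0 hN₁]
    · simp only [Sum.elim_inr, Function.comp_apply, Fin.zero_eta, Fin.isValue, Matrix.cons_val_zero]
      rw [hx2, div_pow_eq_rescale ht0 hN₂]
    · simp only [Sum.elim_inr, Function.comp_apply, Fin.mk_one, Fin.isValue, Matrix.cons_val_one,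
        Matrix.cons_val_zero]
      rw [hx3, div_pow_eq_rescale ht0 hN₃]
  -- small parameters are available
  have hsmall : ∀ ε : ℝ, 0 < ε → ∃ x, x ∈ T' ∧ x ∈ U ((y₁, M₁), ((y₂, M₂), (y₃, M₃))) ∧
      tr x ≠ 0 ∧ ‖tr x‖ < ε := by
    intro ε hε
    obtain ⟨x, hxT', hxU, hxε⟩ := (hcls (ε⁻¹ ^ e)).nonempty
    obtain ⟨h0, hlt⟩ := ne_zero_and_norm_lt_of_pow_eq_inv he hε (htr x) hxε
    exact ⟨x, hxT', hxU, h0, hlt⟩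
  -- ### the branch lies in `W`
  obtain ⟨J, hJ⟩ := hcl
  obtain ⟨G, hG⟩ := (isNoetherian_def.1 (inferInstance : IsNoetherian
    (MvPolynomial (Fin 2 ⊕ Fin 2) ℂ) (MvPolynomial (Fin 2 ⊕ Fin 2) ℂ))) J
  have hcoord : ∀ k : Fin 2 ⊕ Fin 2, ∃ K : ℕ,
      AnalyticAt ℂ (fun t : ℂ => t ^ K * 𝔟[e, N, Φ₁, Φ₂, Φ₃, t] k) 0 := by
    have h0 : ‖(0 : ℂ)‖ < r₀ := by rw [norm_zero]; exact hr₀pos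
    obtain ⟨ha₁, ha₂, ha₃⟩ := hanΦ 0 h0
    intro k
    rcases k with k | k <;> fin_cases k
    · exact ⟨e + 1, analyticAt_pow_succ_mul_inv_pow e⟩
    · exact ⟨N + 1, analyticAt_pow_succ_mul_div_pow ha₁ N⟩
    · exact ⟨N + 1, analyticAt_pow_succ_mul_div_pow ha₂ N⟩
    · exact ⟨N + 1, analyticAt_pow_succ_mul_div_pow ha₃ N⟩
  have hrad : ∀ p ∈ G, ∃ δ > 0, ∀ t : ℂ, 0 < ‖t‖ → ‖t‖ < δ →
      MvPolynomial.aeval 𝔟[e, N, Φ₁, Φ₂, Φ₃, t] p = 0 := by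
    intro p hp
    obtain ⟨K, hK⟩ := exists_analyticAt_pow_mul_aeval (fun t : ℂ => 𝔟[e, N, Φ₁, Φ₂, Φ₃, t]) hcoord p
    refine exists_radius_eq_zero hK (frequently_nhdsNE_of_forall_exists fun ε hε => ?_)
    obtain ⟨x, hxT', hxU, h0, hlt⟩ := hsmall ε hε
    refine ⟨tr x, norm_pos_iff.2 h0, hlt, ?_⟩
    rw [← hpt x hxU h0]
    have hxW : Sum.elim x (exp ∘ x) ∈ W := (hTW hxT'.1).2
    rw [hJ, MvPolynomial.mem_zeroLocus_iff] at hxW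
    exact hxW p (hG ▸ Ideal.subset_span hp)
  choose! δp hδp hzero using hrad
  set δ₀ : ℝ := if hG0 : G.Nonempty then G.inf' hG0 δp else 1 with hδ₀
  have hδ₀pos : 0 < δ₀ := by
    rw [hδ₀]; split_ifs with hG0
    · exact (Finset.lt_inf'_iff hG0).2 fun p hp => hδp p hp
    · exact one_pos
  have hδ₀le : ∀ p ∈ G, δ₀ ≤ δp p := fun p hp => by
    rw [hδ₀, dif_pos ⟨p, hp⟩]; exact Finset.inf'_le _ hp
  set r : ℝ := min r₀ δ₀ with hr
  have hrpos : 0 < r := lt_min hr₀pos hδ₀pos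
  refine ⟨e, he, N, r, hrpos, Φ₁, Φ₂, Φ₃, fun t ht => hanΦ t (ht.trans_le (min_le_left _ _)),
    fun t ht0 htr => ?_, fun δ hδ => ?_⟩
  · -- in `W`
    rw [hJ, ← hG, MvPolynomial.zeroLocus_span]
    intro p hp
    exact hzero p hp t ht0 (htr.trans_le ((min_le_right _ _).trans (hδ₀le p hp)))
  · -- infinitely many hits with small parameters
    refine (hcls (δ⁻¹ ^ e)).mono ?_
    rintro x ⟨hxT', hxU, hxδ⟩
    obtain ⟨h0, hlt⟩ := ne_zero_and_norm_lt_of_pow_eq_inv he hδ (htr x) hxδ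
    exact ⟨hxT'.1, tr x, norm_pos_iff.2 h0, hlt, hpt x hxU h0⟩

end Literature.NumberTheory.Transcendental

end
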